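import Mathlib

/-!
# Baer's theorem: a polarity of a projective plane of non-square order has exactly `n + 1`
absolute points — stub `stub_tangencySets` (crux `LevelOneGL2Designs`,
stmt-MatrixMultiplication-14080), wall-breaker axis 7/12 "Hermitian unital constructions",
generation 1

The one mechanism that produces tangency sets of order `q^{3/2}` in a finite plane is the
unitary POLARITY of a square-order plane: the classical unital is its set of absolute points,
and the tangent at an absolute point is its polar (`FlagLine.TangencyHermitian.hermitian_srs`
realises the stub verbatim over every field of order `q²`).  The stub lives in the plane of PRIME
order `p`.  This file proves, for Mathlib's ABSTRACT finite projective planes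
(`Configuration.ProjectivePlane P L`, Desarguesian or not), the theorem of Baer (1946) that closes
this mechanism in every plane of non-square order:

* `polarity_injective` — a map `φ : P → L` with symmetric incidence (`p ∈ φ q ↔ q ∈ φ p`, a
  *polarity*) is injective, hence bijective;
* `card_absolute_eq_of_not_isSquare` (**Baer**) — if the order `n` is not a perfect square, `φ`
  has EXACTLY `n + 1` absolute points (`p ∈ φ p`);
* `card_absolute_eq_of_prime`, `card_polar_flags_le_of_prime` — in particular in a plane of
  prime order `p` every polarity has `p + 1` absolute points, so a family of flags
  `(x, φ x)`, `x ∈ φ x` — "point + polar = tangent", the unital's recipe — has at most `p + 1`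
  members: exponent `1`, against the stub's `c·p^{3/2}`.

Proof (Baer; Hughes–Piper Thm 12.7): the matrix `A_{pq} = [p ∈ φ q]` is real symmetric with
`A² = n·I + J` (row sums `n + 1`, two polars meet in one point), so by the spectral theorem each
eigenvalue is `n + 1` (eigenvector constant, at most once in an orthonormal eigenbasis) or `±√n`;
the trace `#{absolute points} = (n+1)·k1 + √n·(kp − km)` is an integer, so `kp = km` when `√n` is
irrational, and then `k1 ≡ n² + n + 1 ≡ 1 (mod 2)` forces `k1 = 1`.
For the Desarguesian plane `PG(2,p)` this is the familiar count of a conic (the absolute points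
of an orthogonal polarity; `ZMod p` has no involutory automorphism, so it has no unitary
polarities at all); the point of Baer's theorem is that no exotic plane of prime order could do
better either.  [cite: Baer1946PolaritiesFiniteProjectivePlanes, Thm 6 (R. Baer, *Polarities in
finite projective planes*, Bull. AMS 52 (1946) 77–93); Hughes–Piper, *Projective Planes*, Thm 12.7]
Mathlib only (`Configuration.ProjectivePlane`, `Matrix.IsHermitian.eigenvectorBasis`,
`irrational_sqrt_natCast_iff`); no definitions.
-/

-- `Summit.MatrixMultiplication.MatrixMultiplication.…` is the tree's mandated summit/problem namespace (D-0017).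
set_option linter.dupNamespace false

namespace Summit.MatrixMultiplication.MatrixMultiplication.Theorems.LevelOneGL2Designs.BaerPolarity

open Finset Matrix Configuration

variable {P L : Type*} [Membership P L] [Configuration.ProjectivePlane P L]

section Incidence

variable [Finite P] [Finite L]

/-- In a projective plane any two lines (equal or not) have a common point. [elementary] -/
theorem exists_mem_mem (l₁ l₂ : L) : ∃ q : P, q ∈ l₁ ∧ q ∈ l₂ := by
  by_cases h : l₁ = l₂
  · subst h
    have h2 := ProjectivePlane.two_lt_pointCount P l₁
    have hpos : 0 < Nat.card {q : P // q ∈ l₁} := by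
      unfold Configuration.pointCount at h2
      omega
    obtain ⟨⟨q, hq⟩⟩ := (Nat.card_pos_iff.mp hpos).1
    exact ⟨q, hq, hq⟩
  · exact ⟨_, (HasPoints.mkPoint_ax h).1, (HasPoints.mkPoint_ax h).2⟩

/-- **A polarity is injective.**  If `φ : P → L` satisfies `p ∈ φ q ↔ q ∈ φ p` then `φ` is
injective (so, the plane being finite, a bijection between points and lines).  If `φ p = φ r`
with `p ≠ r`, every point `q` of that line has `p, r ∈ φ q`, so `φ q` is the line `pr`; a point
`x` off `pr` has its polar meeting `φ p` in some `q`, whence `x ∈ φ q = pr`, absurd. [elementary] -/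
theorem polarity_injective (φ : P → L) (hφ : ∀ p q, p ∈ φ q ↔ q ∈ φ p) :
    Function.Injective φ := by
  intro p r hpr
  by_contra hne
  have hm := HasLines.mkLine_ax (P := P) (L := L) hne
  have hall : ∀ q, q ∈ φ p → φ q = HasLines.mkLine hne := by
    intro q hq
    have hpq : p ∈ φ q := (hφ p q).mpr hq
    have hrq : r ∈ φ q := (hφ r q).mpr (hpr ▸ hq)
    rcases Nondegenerate.eq_or_eq hpq hrq hm.1 hm.2 with h | h
    · exact (hne h).elim
    · exact h
  obtain ⟨x, hx⟩ := Nondegenerate.exists_point (P := P) (HasLines.mkLine hne : L)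
  obtain ⟨q, hqx, hqp⟩ := exists_mem_mem (P := P) (φ x) (φ p)
  have hxq : x ∈ φ q := (hφ x q).mpr hqx
  rw [hall q hqp] at hxq
  exact hx hxq

end Incidence

section Counting

variable [Fintype P] [Fintype L]

open scoped Classical in
/-- The polar `φ p` has `n + 1` points; by symmetry these are the `q` with `p ∈ φ q`.
[bookkeeping] -/
theorem card_filter_mem_polar (φ : P → L) (hφ : ∀ p q, p ∈ φ q ↔ q ∈ φ p) (p : P) :
    (univ.filter fun q => p ∈ φ q).card = ProjectivePlane.order P L + 1 := by
  have h1 : (univ.filter fun q => p ∈ φ q) = univ.filter fun q => q ∈ φ p := by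
    ext q
    simp [hφ p q]
  rw [h1, ← ProjectivePlane.pointCount_eq P (φ p), Configuration.pointCount,
    Nat.card_eq_fintype_card, Fintype.card_subtype]

open scoped Classical in
/-- Two distinct polars meet in exactly one point; a polar meets itself in `n + 1` points.
[bookkeeping] -/
theorem card_filter_mem_mem (φ : P → L) (hφ : ∀ p q, p ∈ φ q ↔ q ∈ φ p) (p r : P) :
    (univ.filter fun q => q ∈ φ p ∧ q ∈ φ r).card =
      if p = r then ProjectivePlane.order P L + 1 else 1 := by
  split_ifs with hpr
  · subst hpr
    have h1 : (univ.filter fun q => q ∈ φ p ∧ q ∈ φ p) = univ.filter fun q => q ∈ φ p := by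
      ext q
      simp
    rw [h1, ← ProjectivePlane.pointCount_eq P (φ p), Configuration.pointCount,
      Nat.card_eq_fintype_card, Fintype.card_subtype]
  · have hne : φ p ≠ φ r := fun h => hpr (polarity_injective φ hφ h)
    obtain ⟨q₀, hq₀, huniq⟩ := HasPoints.existsUnique_point P L (φ p) (φ r) hne
    rw [Finset.card_eq_one]
    refine ⟨q₀, Finset.eq_singleton_iff_unique_mem.mpr ⟨by simpa using hq₀, fun q hq => ?_⟩⟩
    exact huniq q (by simpa using hq)

/-- **Baer's theorem (1946).**  In a finite projective plane whose order `n` is not a perfect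
square, every polarity `φ` (`p ∈ φ q ↔ q ∈ φ p`) has exactly `n + 1` absolute points.
Spectral proof: `A_{pq} = [p ∈ φ q]` is symmetric with `A² = nI + J`; eigenvalues `n + 1` (once)
and `±√n`; the trace is the number of absolute points, an integer, so the multiplicities of
`±√n` agree (irrationality of `√n`) and parity of `n² + n + 1` leaves exactly one eigenvalue
`n + 1`. [cite: Baer1946PolaritiesFiniteProjectivePlanes, Thm 6; Hughes–Piper Thm 12.7] -/
theorem card_absolute_eq_of_not_isSquare (φ : P → L) (hφ : ∀ p q, p ∈ φ q ↔ q ∈ φ p)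
    (hn : ¬ IsSquare (ProjectivePlane.order P L)) :
    Nat.card {p // p ∈ φ p} = ProjectivePlane.order P L + 1 := by
  classical
  set n : ℕ := ProjectivePlane.order P L with hn_def
  have hn1 : 1 < n := ProjectivePlane.one_lt_order P L
  have hn0 : (0 : ℝ) < n := by exact_mod_cast (zero_lt_one.trans hn1)
  have hNcard : Fintype.card P = n ^ 2 + n + 1 := ProjectivePlane.card_points P L
  -- the incidence matrix of the polarity
  set A : Matrix P P ℝ := Matrix.of fun p q => if p ∈ φ q then (1 : ℝ) else 0 with hA_def
  have hAH : A.IsHermitian := by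
    refine Matrix.IsHermitian.ext fun p q => ?_
    simp only [hA_def, Matrix.of_apply, star_trivial, hφ q p]
  have hrow : ∀ p, ∑ q, A p q = (n : ℝ) + 1 := by
    intro p
    simp only [hA_def, Matrix.of_apply, Finset.sum_boole]
    rw [card_filter_mem_polar φ hφ p]
    push_cast
    ring
  have hA2 : ∀ p r, (A * A) p r = if p = r then (n : ℝ) + 1 else 1 := by
    intro p r
    rw [Matrix.mul_apply]
    have h1 : ∀ q, A p q * A q r = if q ∈ φ p ∧ q ∈ φ r then (1 : ℝ) else 0 := by
      intro q
      simp only [hA_def, Matrix.of_apply, hφ p q]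
      split_ifs <;> simp_all
    rw [Finset.sum_congr rfl fun q _ => h1 q, Finset.sum_boole, card_filter_mem_mem φ hφ p r]
    split_ifs <;> push_cast <;> ring
  have htr : A.trace = (Nat.card {p // p ∈ φ p} : ℝ) := by
    rw [Nat.card_eq_fintype_card, Fintype.card_subtype]
    simp only [Matrix.trace, Matrix.diag, hA_def, Matrix.of_apply, Finset.sum_boole]
  -- spectral data
  set ev : P → ℝ := hAH.eigenvalues with hev_def
  set b := hAH.eigenvectorBasis with hb_def
  have key : ∀ i p, ((ev i) ^ 2 - n) * b i p = ∑ r, b i r := by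
    intro i p
    have h1 : A *ᵥ ⇑(b i) = ev i • ⇑(b i) := hAH.mulVec_eigenvectorBasis i
    have h2 : (A * A) *ᵥ ⇑(b i) = (ev i) ^ 2 • ⇑(b i) := by
      rw [← Matrix.mulVec_mulVec, h1, Matrix.mulVec_smul, h1, smul_smul, sq]
    have h3 := congrFun h2 p
    simp only [Matrix.mulVec, dotProduct, Pi.smul_apply, smul_eq_mul] at h3
    have h4 : ∑ r, (A * A) p r * b i r = n * b i p + ∑ r, b i r := by
      have h5 : ∀ r, (A * A) p r * b i r = b i r + (if p = r then (n : ℝ) * b i r else 0) := by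
        intro r
        rw [hA2 p r]
        split_ifs <;> ring
      rw [Finset.sum_congr rfl fun r _ => h5 r, Finset.sum_add_distrib, Finset.sum_ite_eq]
      simp only [Finset.mem_univ, if_true]
      ring
    linear_combination h4 - h3
  have hne0 : ∀ i, ∃ p, b i p ≠ 0 := by
    intro i
    have h5 : b i ≠ 0 := b.orthonormal.ne_zero i
    have h6 : (⇑(b i) : P → ℝ) ≠ 0 := fun h => h5 ((WithLp.ofLp_eq_zero 2).mp h)
    exact Function.ne_iff.mp h6
  -- every eigenvalue is `n + 1` or a square root of `n`
  have hcases : ∀ i, ev i = n + 1 ∨ (ev i) ^ 2 = n := by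
    intro i
    obtain ⟨p₀, hp₀⟩ := hne0 i
    set s : ℝ := ∑ r, b i r with hs_def
    by_cases hs : s = 0
    · right
      have h1 := key i p₀
      rw [← hs_def, hs] at h1
      rcases mul_eq_zero.mp h1 with h | h
      · linarith
      · exact (hp₀ h).elim
    · left
      have hd : (ev i) ^ 2 - n ≠ 0 := by
        intro hd
        have h1 := key i p₀
        rw [hd, zero_mul] at h1
        exact hs (hs_def.trans h1.symm)
      obtain ⟨c, hc⟩ : ∃ c : ℝ, ∀ p, b i p = c :=
        ⟨s / ((ev i) ^ 2 - n), fun p => by rw [eq_div_iff hd, mul_comm]; exact key i p⟩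
      have hc0 : c ≠ 0 := fun h => hp₀ ((hc p₀).trans h)
      have h1 := congrFun (hAH.mulVec_eigenvectorBasis i) p₀
      simp only [Matrix.mulVec, dotProduct, Pi.smul_apply, smul_eq_mul] at h1
      change ∑ q, A p₀ q * b i q = ev i * b i p₀ at h1
      simp only [hc] at h1
      rw [← Finset.sum_mul, hrow p₀] at h1
      exact (mul_right_cancel₀ hc0 h1).symm
  -- the eigenvalue `n + 1` occurs at most once in the orthonormal eigenbasis
  have hone : ∀ i j, ev i = n + 1 → ev j = n + 1 → i = j := by
    intro i j hi hj
    by_contra hij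
    have hdpos : ((n : ℝ) + 1) ^ 2 - n ≠ 0 := by nlinarith
    obtain ⟨ci, hci⟩ : ∃ c : ℝ, ∀ p, b i p = c :=
      ⟨(∑ r, b i r) / (((n : ℝ) + 1) ^ 2 - n), fun p => by
        rw [eq_div_iff hdpos, mul_comm, ← hi]; exact key i p⟩
    obtain ⟨cj, hcj⟩ : ∃ c : ℝ, ∀ p, b j p = c :=
      ⟨(∑ r, b j r) / (((n : ℝ) + 1) ^ 2 - n), fun p => by
        rw [eq_div_iff hdpos, mul_comm, ← hj]; exact key j p⟩
    obtain ⟨p₀, hp₀⟩ := hne0 i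
    obtain ⟨p₁, hp₁⟩ := hne0 j
    have hci0 : ci ≠ 0 := fun h => hp₀ ((hci p₀).trans h)
    have hcj0 : cj ≠ 0 := fun h => hp₁ ((hcj p₁).trans h)
    have horth : inner ℝ (b i) (b j) = (0 : ℝ) := by
      rw [orthonormal_iff_ite.mp b.orthonormal i j, if_neg hij]
    have horth' : ∑ p, b i p * b j p = 0 := by
      rw [PiLp.inner_apply] at horth
      simpa [mul_comm] using horth
    simp only [hci, hcj, Finset.sum_const, Finset.card_univ, nsmul_eq_mul] at horth'
    have hN0 : (Fintype.card P : ℝ) ≠ 0 := by exact_mod_cast (Fintype.card_pos_iff.mpr ⟨p₀⟩).ne'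
    rcases mul_eq_zero.mp horth' with h | h
    · exact hN0 h
    · rcases mul_eq_zero.mp h with h | h
      · exact hci0 h
      · exact hcj0 h
  -- square roots
  have hsqrt_pos : 0 < √(n : ℝ) := Real.sqrt_pos.mpr hn0
  have hsqrt_lt : √(n : ℝ) < n + 1 := by
    rw [Real.sqrt_lt' (by positivity)]
    nlinarith
  have hsq : ∀ i, (ev i) ^ 2 = n → ev i = √(n : ℝ) ∨ ev i = -√(n : ℝ) := by
    intro i h
    rw [← Real.sq_sqrt hn0.le] at h
    exact sq_eq_sq_iff_eq_or_eq_neg.mp h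
  -- indicator decomposition of each eigenvalue
  have hind : ∀ i, ev i = ((n : ℝ) + 1) * (if ev i = (n : ℝ) + 1 then 1 else 0)
      + √(n : ℝ) * (if ev i = √(n : ℝ) then 1 else 0)
      - √(n : ℝ) * (if ev i = -√(n : ℝ) then 1 else 0) := by
    intro i
    rcases hcases i with h | h
    · rw [if_pos h, if_neg (by rw [h]; exact hsqrt_lt.ne'), if_neg (by rw [h]; intro h'; linarith)]
      linarith
    · rcases hsq i h with h | h
      · rw [if_neg (by rw [h]; exact hsqrt_lt.ne), if_pos h, if_neg (by rw [h]; intro h'; linarith)]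
        linarith
      · rw [if_neg (by rw [h]; intro h'; linarith), if_neg (by rw [h]; intro h'; linarith), if_pos h]
        linarith
  have hpart : ∀ i, (if ev i = (n : ℝ) + 1 then (1 : ℝ) else 0)
      + (if ev i = √(n : ℝ) then 1 else 0) + (if ev i = -√(n : ℝ) then 1 else 0) = 1 := by
    intro i
    rcases hcases i with h | h
    · rw [if_pos h, if_neg (by rw [h]; exact hsqrt_lt.ne'), if_neg (by rw [h]; intro h'; linarith)]
      ring
    · rcases hsq i h with h | h
      · rw [if_neg (by rw [h]; exact hsqrt_lt.ne), if_pos h, if_neg (by rw [h]; intro h'; linarith)]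
        ring
      · rw [if_neg (by rw [h]; intro h'; linarith), if_neg (by rw [h]; intro h'; linarith), if_pos h]
        ring
  -- the three multiplicities
  set k1 : ℕ := (univ.filter fun i => ev i = (n : ℝ) + 1).card with hk1
  set kp : ℕ := (univ.filter fun i => ev i = √(n : ℝ)).card with hkp
  set km : ℕ := (univ.filter fun i => ev i = -√(n : ℝ)).card with hkm
  have htrace : (Nat.card {p // p ∈ φ p} : ℝ) = ((n : ℝ) + 1) * k1 + √(n : ℝ) * kp - √(n : ℝ) * km := by
    rw [← htr, hAH.trace_eq_sum_eigenvalues]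
    simp only [RCLike.ofReal_real_eq_id, id_eq]
    change ∑ i, ev i = _
    rw [Finset.sum_congr rfl fun i _ => hind i, Finset.sum_sub_distrib, Finset.sum_add_distrib,
      ← Finset.mul_sum, ← Finset.mul_sum, ← Finset.mul_sum, Finset.sum_boole, Finset.sum_boole,
      Finset.sum_boole]
  have hsum : k1 + kp + km = n ^ 2 + n + 1 := by
    have h1 : ((k1 : ℝ) + kp + km) = Fintype.card P := by
      rw [hk1, hkp, hkm, ← Finset.sum_boole, ← Finset.sum_boole, ← Finset.sum_boole,
        ← Finset.sum_add_distrib, ← Finset.sum_add_distrib,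
        Finset.sum_congr rfl fun i _ => hpart i]
      simp
    rw [← hNcard]
    exact_mod_cast h1
  have hk1le : k1 ≤ 1 := by
    rw [hk1]
    refine Finset.card_le_one.mpr fun i hi j hj => ?_
    simp only [Finset.mem_filter, Finset.mem_univ, true_and] at hi hj
    exact hone i j hi hj
  -- irrationality of `√n`: the multiplicities of `±√n` agree
  have hkeq : kp = km := by
    by_contra hkne
    have hirr : Irrational √(n : ℝ) := irrational_sqrt_natCast_iff.mpr hn
    have hd : ((kp : ℝ) - km) ≠ 0 := by
      intro h
      apply hkne
      exact_mod_cast (sub_eq_zero.mp h)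
    have hdZ : ((kp : ℤ) - km) ≠ 0 := by
      intro h
      apply hkne
      exact_mod_cast (sub_eq_zero.mp h)
    apply (irrational_iff_ne_rational _).mp hirr
      ((Nat.card {p // p ∈ φ p} : ℤ) - (n + 1) * k1) ((kp : ℤ) - km) hdZ
    rw [eq_div_iff (by exact_mod_cast hd)]
    push_cast
    linear_combination -htrace
  -- parity: exactly one eigenvalue `n + 1`
  have hk1eq : k1 = 1 := by
    obtain ⟨t, ht⟩ := Nat.even_mul_succ_self n
    obtain ⟨m, hm⟩ : ∃ m, n * (n + 1) = m := ⟨_, rfl⟩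
    have hsq' : n ^ 2 + n = n * (n + 1) := by ring
    have h1 : k1 + 2 * kp = m + 1 := by rw [← hkeq] at hsum; linarith [hsum, hsq', hm]
    rw [hm] at ht
    omega
  -- conclusion
  have hfin : (Nat.card {p // p ∈ φ p} : ℝ) = n + 1 := by
    rw [htrace, hkeq, hk1eq]
    push_cast
    ring
  exact_mod_cast hfin

/-- **Prime order.**  A prime is not a perfect square, so in a projective plane of prime order
`p` every polarity has exactly `p + 1` absolute points. [cite:
Baer1946PolaritiesFiniteProjectivePlanes, Thm 6 (corollary)] -/
theorem card_absolute_eq_of_prime (φ : P → L) (hφ : ∀ p q, p ∈ φ q ↔ q ∈ φ p)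
    (hp : (ProjectivePlane.order P L).Prime) :
    Nat.card {p // p ∈ φ p} = ProjectivePlane.order P L + 1 := by
  refine card_absolute_eq_of_not_isSquare φ hφ ?_
  rintro ⟨m, hm⟩
  rw [hm, Nat.prime_mul_iff] at hp
  rcases hp with ⟨h, rfl⟩ | ⟨h, rfl⟩ <;> exact Nat.not_prime_one h

/-- **Absolute flags of a polarity.**  In a projective plane of non-square order `n`, a family of
flags `(x, ℓ)` whose line is the polar of its point under one polarity `φ` (`ℓ = φ x`, `x ∈ ℓ` —
"the tangent at a point of the unital is its polar") has at most `n + 1` members: its points are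
distinct absolute points. [cite: Baer1946PolaritiesFiniteProjectivePlanes, Thm 6 (corollary)] -/
theorem card_polar_flags_le_of_not_isSquare (φ : P → L) (hφ : ∀ p q, p ∈ φ q ↔ q ∈ φ p)
    (hn : ¬ IsSquare (ProjectivePlane.order P L)) (S : Finset (P × L))
    (hS : ∀ f ∈ S, f.2 = φ f.1 ∧ f.1 ∈ f.2) :
    S.card ≤ ProjectivePlane.order P L + 1 := by
  classical
  rw [← card_absolute_eq_of_not_isSquare φ hφ hn, Nat.card_eq_fintype_card, Fintype.card_subtype]
  refine Finset.card_le_card_of_injOn Prod.fst (fun f hf => ?_) ?_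
  · obtain ⟨h2, h1⟩ := hS f (by simpa using hf)
    simp only [Finset.coe_filter, Finset.mem_univ, true_and, Set.mem_setOf_eq]
    rw [← h2]
    exact h1
  · intro f hf f' hf' h
    obtain ⟨h2, -⟩ := hS f (by simpa using hf)
    obtain ⟨h2', -⟩ := hS f' (by simpa using hf')
    exact Prod.ext h (by rw [h2, h2', h])

/-- **Prime order, flag form.**  In a projective plane of PRIME order `p` (such as `PG(2,p)`, the
projective closure of the plane of `stub_tangencySets`), point–polar flags of a polarity number at
most `p + 1`: the unital recipe "absolute points + polars" yields exponent `1`, not `3/2`.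
[cite: Baer1946PolaritiesFiniteProjectivePlanes, Thm 6 (corollary)] -/
theorem card_polar_flags_le_of_prime (φ : P → L) (hφ : ∀ p q, p ∈ φ q ↔ q ∈ φ p)
    (hp : (ProjectivePlane.order P L).Prime) (S : Finset (P × L))
    (hS : ∀ f ∈ S, f.2 = φ f.1 ∧ f.1 ∈ f.2) :
    S.card ≤ ProjectivePlane.order P L + 1 := by
  refine card_polar_flags_le_of_not_isSquare φ hφ ?_ S hS
  rintro ⟨m, hm⟩
  rw [hm, Nat.prime_mul_iff] at hp
  rcases hp with ⟨h, rfl⟩ | ⟨h, rfl⟩ <;> exact Nat.not_prime_one h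

end Counting

end Summit.MatrixMultiplication.MatrixMultiplication.Theorems.LevelOneGL2Designs.BaerPolarity
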